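import Literature.AlgebraicGeometry.Motives.HodgeStructureLefschetzGroupFiniteDirectSum
import Literature.AlgebraicGeometry.Motives.HodgeStructureLefschetzGroupFiniteDirectSumPoints
import Literature.AlgebraicGeometry.Motives.HodgeStructureDirectSumSchurBlocks
import HarnessLib

/-!
# Milne 1999, Propositions 1.1 and 1.5 in their printed shape: for pairwise `Hom`-orthogonal (e.g. irreducible pairwise
# non-isomorphic) Hodge structures `H_j` and multiplicities `κ_j ≠ ∅`, `C(⊕_j H_j^{⊕κ_j}) ≅ ∏_j C(H_j)` and
# `S(⊕_j H_j^{⊕κ_j})(K) ≅ ∏_j S(H_j)(K)` for every field `K ⊇ ℚ` ("A₁^{r₁} × ⋯ × A_s^{r_s} → A … induces an isomorphism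
# S(A₁) × ⋯ × S(A_s) → S(A)")

[topic AlgebraicGeometry/Motives]

Layer `Literature/AlgebraicGeometry/Motives`, lane `lit-hodgefound` (Track 2 foundations library; seat `lit-hodgefound-p34`,
generation 21, FILE 2 of the self-proposed row g21-#4). Definitions WITH BODIES (five bundled isomorphisms) and theorems; no
named fact (net debt `0`). This file only COMPOSES: the finite-family isomorphisms of the seat's g21-#2 files
(`Motives/HodgeStructureLefschetzGroupFiniteDirectSum`: `centralizerPiAlgEquiv`, `centralizerPiConstAlgEquiv`,
`Polarization.lefschetzGroupPiMulEquiv`, `Polarization.lefschetzGroupPiConstMulEquiv`;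
`Motives/HodgeStructureLefschetzGroupFiniteDirectSumPoints`: `Polarization.lefschetzGroupBaseChangePiMulEquiv`,
`Polarization.lefschetzGroupBaseChangePiConstMulEquiv`) with the `Hom`-orthogonality of powers of pairwise `Hom`-orthogonal
summands (FILE 1 `Motives/HodgeStructureDirectSumSchurBlocks`: `forall_hom_pi_const_toLinearMap_eq_zero`, and Schur
`forall_hom_toLinearMap_eq_zero_of_isIrreducible`) into the PRINTED shape of Milne's Propositions 1.1 and 1.5: the model
`⊕_j H_j^{⊕κ_j}` of "`A₁^{r₁} × ⋯ × A_s^{r_s}`" is the iterated finite direct sum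
`HodgeStructure.pi (fun j ↦ HodgeStructure.pi (fun _ : κ j ↦ H j))` on `Π_j (κ_j → W_j)`, polarized by
`Polarization.pi (fun j ↦ Polarization.pi (fun _ ↦ Q j))`, with `κ_j` non-empty finite types ("`rᵢ > 0`").

## The source, verbatim

J. S. Milne, *Lefschetz classes on abelian varieties*, Duke Math. J. **96** (1999) 639–675 [Milne1999LefschetzClasses]
(held `paper:doi-10-1215-s0012-7094-99-09620-5`; Duke page ≈ folio + 638):
* §1 p0005 L27–L31 (p. 643): "**Proposition 1.1.** Let `A₁, …, A_s` be a set of representatives for the simple isogeny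
  factors of `A`, so that there exists an isogeny `A₁^{r₁} × ⋯ × A_s^{r_s} → A` for some `rᵢ > 0`. Any such isogeny induces
  an isomorphism `C(A₁) × ⋯ × C(A_s) → C(A)` of `k`-algebras with involution, which is independent of the choice of the
  isogeny."
* §1 p0006 L24–L29 (p. 644): "**Proposition 1.5.** Let `A₁, …, A_s` be a set of representatives for the simple isogeny
  factors of `A`, so that there exists an isogeny `A₁^{r₁} × ⋯ × A_s^{r_s} → A` for some `rᵢ > 0`. Any such isogeny induces
  an isomorphism `S(A₁) × ⋯ × S(A_s) → S(A)`, which is independent of the choice of the isogeny. Proof. This is an immediate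
  consequence of Proposition 1.1."; L30–L34: Remark 1.6 (`S'(A) ≅ S(A)_{/k'}` — the licence to read Proposition 1.5 on
  `K`-points for every field `K ⊇ ℚ`).
* Schur's lemma for irreducible Hodge structures: D. Huybrechts, *Lectures on K3 Surfaces* [Huybrechts2016K3], Ch. 3
  Cor. 3.3.6 (the tree's `Hom.eq_zero_of_not_exists_hom_bijective`).

## What is PROVED (pairwise `Hom`-orthogonal `H_j` — in particular irreducible pairwise non-isomorphic ones — and
non-empty finite `κ_j`)

* §1 **`centralizerIsogenyFactorsAlgEquiv H κ h0 : (∀ j, C(H_j)) ≃ₐ[ℚ] C(⊕_j H_j^{⊕κ_j})`**, `(c_j) ↦ diag_j(diag_{κ_j}(c_j))`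
  (Prop. 1.1 "`C(A₁) × ⋯ × C(A_s) → C(A)`"), and `…OfIsIrreducible` (hypotheses: `H_j` irreducible, pairwise non-isomorphic).
* §2 **`Polarization.lefschetzGroupIsogenyFactorsMulEquiv κ Q h0 : (∀ j, S(H_j)(ℚ)) ≃* S(⊕_j H_j^{⊕κ_j})(ℚ)`**,
  `(g_j) ↦ Π_j Π_{κ_j} g_j` (`coe_…_apply`), and `…OfIsIrreducible` (Prop. 1.5 on `ℚ`-points).
* §3 **`Polarization.lefschetzGroupBaseChangeIsogenyFactorsMulEquiv κ Q K h0 : (∀ j, S(H_j)(K)) ≃* S(⊕_j H_j^{⊕κ_j})(K)`**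
  for every field `K ⊇ ℚ`, `(γ_j) ↦ ⊕_j Δ_{κ_j}(γ_j) = piBlockDiag (j ↦ piDiagEmbedding γ_j)` (`coe_…_apply`), the membership
  form `Polarization.mem_lefschetzGroupBaseChange_isogenyFactors_iff` (`γ ∈ S(⊕_j H_j^{⊕κ_j})(K)` iff `γ = ⊕_j Δ(γ_j)` with
  `γ_j ∈ S(H_j)(K)`), and `…OfIsIrreducible` (Prop. 1.5 with Remark 1.6).

NOT here: the isogeny `A₁^{r₁} × ⋯ × A_s^{r_s} → A` itself and "independent of the choice of the isogeny" (transport of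
`C` / `S` along an isomorphism of polarized Hodge structures: `Motives/HodgeStructureLefschetzGroupTransport` BY NAME), the
involution clause of Prop. 1.1 (g21-#2's `Polarization.adjoint_pi_piDiag`), existence of the decomposition into
irreducibles (`Motives/HodgeStructureIrreducibleDecomposition` BY NAME).

## References

* [Milne1999LefschetzClasses] J. S. Milne, *Lefschetz classes on abelian varieties*, Duke Math. J. 96 (1999) 639–675, §1
  Propositions 1.1, 1.5, Remark 1.6 (pp. 643–644).
* [Huybrechts2016K3] D. Huybrechts, *Lectures on K3 Surfaces*, CUP (2016), Ch. 3 Cor. 3.3.6.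
-/

noncomputable section

open TensorProduct

namespace Literature.AlgebraicGeometry.Motives

namespace HodgeStructure

universe u uK

variable {ι : Type} [Fintype ι] [DecidableEq ι] {W : ι → Type u} [∀ j, AddCommGroup (W j)] [∀ j, Module ℚ (W j)]
  {n : ℤ} (H : ∀ j, HodgeStructure (W j) n)
  (κ : ι → Type) [∀ j, Fintype (κ j)] [∀ j, DecidableEq (κ j)] [∀ j, Nonempty (κ j)]

/-! ## §1 The algebra `C`: `∏_j C(H_j) ≃ₐ C(⊕_j H_j^{⊕κ_j})` -/

/-- **Proposition 1.1 in its printed shape, for the endomorphism centralizers**: for pairwise `Hom`-orthogonal `H_j` and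
non-empty multiplicities `κ_j`, `(c_j)_j ↦ diag_j(diag_{κ_j}(c_j))` is an isomorphism of `ℚ`-algebras
`∏_j C(H_j) ≃ₐ C(⊕_j H_j^{⊕κ_j})` ("Any such isogeny induces an isomorphism `C(A₁) × ⋯ × C(A_s) → C(A)` of `k`-algebras").
[cite: Milne1999LefschetzClasses, §1 Proposition 1.1] -/
def centralizerIsogenyFactorsAlgEquiv (h0 : ∀ i j, i ≠ j → ∀ φ : Hom (H j) (H i), φ.toLinearMap = 0) :
    (∀ j, Subalgebra.centralizer ℚ ((H j).endAlg : Set (Module.End ℚ (W j)))) ≃ₐ[ℚ]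
      Subalgebra.centralizer ℚ
        ((HodgeStructure.pi fun j ↦ HodgeStructure.pi fun _ : κ j ↦ H j).endAlg : Set (Module.End ℚ (∀ j, κ j → W j))) :=
  (AlgEquiv.piCongrRight fun j ↦ centralizerPiConstAlgEquiv (ι := κ j) (H j)).trans
    (centralizerPiAlgEquiv (fun j ↦ HodgeStructure.pi fun _ : κ j ↦ H j)
      (forall_hom_pi_const_toLinearMap_eq_zero H κ h0))

/-- The same under Milne's literal hypothesis: `H_j` irreducible and pairwise non-isomorphic. [cite: Milne1999LefschetzClasses, §1 Proposition 1.1] [cite: Huybrechts2016K3, Ch. 3 Cor. 3.3.6] -/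
def centralizerIsogenyFactorsAlgEquivOfIsIrreducible (hirr : ∀ j, (H j).IsIrreducible)
    (hniso : ∀ i j, i ≠ j → ¬ ∃ g : Hom (H j) (H i), Function.Bijective g.toLinearMap) :
    (∀ j, Subalgebra.centralizer ℚ ((H j).endAlg : Set (Module.End ℚ (W j)))) ≃ₐ[ℚ]
      Subalgebra.centralizer ℚ
        ((HodgeStructure.pi fun j ↦ HodgeStructure.pi fun _ : κ j ↦ H j).endAlg : Set (Module.End ℚ (∀ j, κ j → W j))) :=
  centralizerIsogenyFactorsAlgEquiv H κ (forall_hom_toLinearMap_eq_zero_of_isIrreducible H hirr hniso)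

/-! ## §2 The group `S` on `ℚ`-points: `∏_j S(H_j)(ℚ) ≃* S(⊕_j H_j^{⊕κ_j})(ℚ)` -/

variable {H} (Q : ∀ j, Polarization (H j))

/-- **Proposition 1.5 in its printed shape, on `ℚ`-points**: for pairwise `Hom`-orthogonal `H_j` and non-empty multiplicities,
`(g_j)_j ↦ Π_j Π_{κ_j} g_j` is an isomorphism `∏_j S(H_j)(ℚ) ≃* S(⊕_j H_j^{⊕κ_j})(ℚ)` ("Any such isogeny induces an
isomorphism `S(A₁) × ⋯ × S(A_s) → S(A)`"). [cite: Milne1999LefschetzClasses, §1 Proposition 1.5] -/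
def Polarization.lefschetzGroupIsogenyFactorsMulEquiv (h0 : ∀ i j, i ≠ j → ∀ φ : Hom (H j) (H i), φ.toLinearMap = 0) :
    (∀ j, (Q j).lefschetzGroup) ≃* (Polarization.pi fun j ↦ Polarization.pi fun _ : κ j ↦ Q j).lefschetzGroup :=
  (MulEquiv.piCongrRight fun j ↦ Polarization.lefschetzGroupPiConstMulEquiv (ι := κ j) (Q j)).trans
    (Polarization.lefschetzGroupPiMulEquiv (fun j ↦ Polarization.pi fun _ : κ j ↦ Q j)
      (forall_hom_pi_const_toLinearMap_eq_zero H κ h0))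

/-- The underlying automorphism: `(g_j)_j ↦ Π_j (Π_{κ_j} g_j)`. [cite: Milne1999LefschetzClasses, §1 Proposition 1.5] -/
theorem Polarization.coe_lefschetzGroupIsogenyFactorsMulEquiv_apply
    (h0 : ∀ i j, i ≠ j → ∀ φ : Hom (H j) (H i), φ.toLinearMap = 0) (g : ∀ j, (Q j).lefschetzGroup) :
    ((Polarization.lefschetzGroupIsogenyFactorsMulEquiv κ Q h0 g :
        (Polarization.pi fun j ↦ Polarization.pi fun _ : κ j ↦ Q j).lefschetzGroup) :
          (∀ j, κ j → W j) ≃ₗ[ℚ] (∀ j, κ j → W j)) =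
      LinearEquiv.piCongrRight fun j ↦ LinearEquiv.piCongrRight fun _ : κ j ↦ (g j : W j ≃ₗ[ℚ] W j) :=
  rfl

/-- The same under Milne's literal hypothesis: `H_j` irreducible and pairwise non-isomorphic. [cite: Milne1999LefschetzClasses, §1 Proposition 1.5] [cite: Huybrechts2016K3, Ch. 3 Cor. 3.3.6] -/
def Polarization.lefschetzGroupIsogenyFactorsMulEquivOfIsIrreducible (hirr : ∀ j, (H j).IsIrreducible)
    (hniso : ∀ i j, i ≠ j → ¬ ∃ g : Hom (H j) (H i), Function.Bijective g.toLinearMap) :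
    (∀ j, (Q j).lefschetzGroup) ≃* (Polarization.pi fun j ↦ Polarization.pi fun _ : κ j ↦ Q j).lefschetzGroup :=
  Polarization.lefschetzGroupIsogenyFactorsMulEquiv κ Q (forall_hom_toLinearMap_eq_zero_of_isIrreducible H hirr hniso)

/-! ## §3 The group `S` on `K`-points: `∏_j S(H_j)(K) ≃* S(⊕_j H_j^{⊕κ_j})(K)` for every field `K ⊇ ℚ` -/

variable (K : Type uK) [Field K] [Algebra ℚ K]

/-- **Proposition 1.5 in its printed shape, on `K`-points (Remark 1.6)**: for pairwise `Hom`-orthogonal `H_j` and non-empty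
multiplicities, `(γ_j)_j ↦ ⊕_j Δ_{κ_j}(γ_j)` is an isomorphism `∏_j S(H_j)(K) ≃* S(⊕_j H_j^{⊕κ_j})(K)`.
[cite: Milne1999LefschetzClasses, §1 Proposition 1.5 and Remark 1.6] -/
def Polarization.lefschetzGroupBaseChangeIsogenyFactorsMulEquiv
    (h0 : ∀ i j, i ≠ j → ∀ φ : Hom (H j) (H i), φ.toLinearMap = 0) :
    (∀ j, (Q j).lefschetzGroupBaseChange K) ≃*
      (Polarization.pi fun j ↦ Polarization.pi fun _ : κ j ↦ Q j).lefschetzGroupBaseChange K :=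
  (MulEquiv.piCongrRight fun j ↦ Polarization.lefschetzGroupBaseChangePiConstMulEquiv K (κ j) (Q j)).trans
    (Polarization.lefschetzGroupBaseChangePiMulEquiv K (fun j ↦ Polarization.pi fun _ : κ j ↦ Q j)
      (forall_hom_pi_const_toLinearMap_eq_zero H κ h0))

/-- The underlying automorphism: `(γ_j)_j ↦ ⊕_j Δ_{κ_j}(γ_j) = piBlockDiag (j ↦ piDiagEmbedding γ_j)`.
[cite: Milne1999LefschetzClasses, §1 Proposition 1.5 and Remark 1.6] -/
theorem Polarization.coe_lefschetzGroupBaseChangeIsogenyFactorsMulEquiv_apply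
    (h0 : ∀ i j, i ≠ j → ∀ φ : Hom (H j) (H i), φ.toLinearMap = 0) (γ : ∀ j, (Q j).lefschetzGroupBaseChange K) :
    ((Polarization.lefschetzGroupBaseChangeIsogenyFactorsMulEquiv κ Q K h0 γ :
        (Polarization.pi fun j ↦ Polarization.pi fun _ : κ j ↦ Q j).lefschetzGroupBaseChange K) :
          (K ⊗[ℚ] (∀ j, κ j → W j)) ≃ₗ[K] (K ⊗[ℚ] (∀ j, κ j → W j))) =
      piBlockDiag K (fun j ↦ κ j → W j) fun j ↦ piDiagEmbedding K (W j) (κ j) (γ j : (K ⊗[ℚ] W j) ≃ₗ[K] (K ⊗[ℚ] W j)) :=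
  rfl

/-- **Membership form**: `γ ∈ S(⊕_j H_j^{⊕κ_j})(K)` iff `γ = ⊕_j Δ_{κ_j}(γ_j)` for (unique) `γ_j ∈ S(H_j)(K)`.
[cite: Milne1999LefschetzClasses, §1 Proposition 1.5 and Remark 1.6] -/
theorem Polarization.mem_lefschetzGroupBaseChange_isogenyFactors_iff
    (h0 : ∀ i j, i ≠ j → ∀ φ : Hom (H j) (H i), φ.toLinearMap = 0)
    (γ : (K ⊗[ℚ] (∀ j, κ j → W j)) ≃ₗ[K] (K ⊗[ℚ] (∀ j, κ j → W j))) :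
    γ ∈ (Polarization.pi fun j ↦ Polarization.pi fun _ : κ j ↦ Q j).lefschetzGroupBaseChange K ↔
      ∃ γ' : ∀ j, (K ⊗[ℚ] W j) ≃ₗ[K] (K ⊗[ℚ] W j), (∀ j, γ' j ∈ (Q j).lefschetzGroupBaseChange K) ∧
        piBlockDiag K (fun j ↦ κ j → W j) (fun j ↦ piDiagEmbedding K (W j) (κ j) (γ' j)) = γ := by
  constructor
  · intro hγ
    obtain ⟨γ', h⟩ := (Polarization.lefschetzGroupBaseChangeIsogenyFactorsMulEquiv κ Q K h0).surjective ⟨γ, hγ⟩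
    exact ⟨fun j ↦ (γ' j : (K ⊗[ℚ] W j) ≃ₗ[K] (K ⊗[ℚ] W j)), fun j ↦ (γ' j).2,
      (Polarization.coe_lefschetzGroupBaseChangeIsogenyFactorsMulEquiv_apply κ Q K h0 γ').symm.trans
        (congr_arg Subtype.val h)⟩
  · rintro ⟨γ', hγ', rfl⟩
    exact (Polarization.lefschetzGroupBaseChangeIsogenyFactorsMulEquiv κ Q K h0 fun j ↦ ⟨γ' j, hγ' j⟩).2

/-- The same under Milne's literal hypothesis: `H_j` irreducible and pairwise non-isomorphic. [cite: Milne1999LefschetzClasses, §1 Proposition 1.5 and Remark 1.6] [cite: Huybrechts2016K3, Ch. 3 Cor. 3.3.6] -/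
def Polarization.lefschetzGroupBaseChangeIsogenyFactorsMulEquivOfIsIrreducible (hirr : ∀ j, (H j).IsIrreducible)
    (hniso : ∀ i j, i ≠ j → ¬ ∃ g : Hom (H j) (H i), Function.Bijective g.toLinearMap) :
    (∀ j, (Q j).lefschetzGroupBaseChange K) ≃*
      (Polarization.pi fun j ↦ Polarization.pi fun _ : κ j ↦ Q j).lefschetzGroupBaseChange K :=
  Polarization.lefschetzGroupBaseChangeIsogenyFactorsMulEquiv κ Q K
    (forall_hom_toLinearMap_eq_zero_of_isIrreducible H hirr hniso)

end HodgeStructure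

end Literature.AlgebraicGeometry.Motives
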